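import Mathlib.FieldTheory.Galois.Basic
import Mathlib.RingTheory.Discriminant
import Mathlib.NumberTheory.NumberField.Discriminant.Defs
import HarnessLib

/-!
# Quadratic extensions in characteristic `≠ 2`: square-root generators and conjugation

Elementary algebra of a quadratic extension `K/F` of fields (`[K : F] = 2`) used by the descent
of the Mordell–Weil rank along `K/F` (`Literature.NumberTheory.EllipticCurves.QuadraticTwistRank`,
Silverman, *The Arithmetic of Elliptic Curves*, Exercise 10.16):

* `exists_sq_eq_algebraMap`: if `2 ≠ 0` in `F` then `K = F(θ)` with `θ ∉ F`, `θ² = c ∈ F`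
  (complete the square in the minimal polynomial of any `z ∈ K \ F`);
* for such a *square-root generator* `θ`: `1, θ` is an `F`-basis (`basisOneSqrt`), every element
  is uniquely `a + bθ` (`exists_eq_add_mul`, `ext_add_mul`), and `a + bθ ↦ a - bθ` is an
  `F`-algebra endomorphism `conj` (`conj_algebraMap`, `conj_gen`, `conj_conj`) whose fixed points
  are exactly `F` (`exists_eq_algebraMap_of_conj_eq`) and whose anti-fixed points are exactly `F θ`
  (`exists_eq_mul_of_conj_eq_neg`) when `2 ≠ 0`;
* for a quadratic number field `K = ℚ(θ)`, `θ² = c`: the field discriminant is `c` up to a nonzero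
  rational square, `d_K = c q²` (`NumberField.exists_discr_eq_mul_sq`; from
  `disc(1, θ) = det (Tr(θ^{i+j})) = 4c` and the change-of-basis formula for discriminants), so that
  `ℚ(√d_K) = K`.

Everything here is proved; Mathlib has the general theory used (`Algebra.discr`,
`Algebra.discr_of_matrix_vecMul`, `NumberField.coe_discr`, `Subalgebra.bot_eq_top_iff_finrank_eq_one`,
`Algebra.IsQuadraticExtension`) but not these elementary normal forms (searched `sqrt`, `Quadratic`
in `Mathlib/FieldTheory`, `Mathlib/NumberTheory/NumberField`: only `Zsqrtd`, `QuadraticAlgebra` as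
abstract structures, and Galois-theoretic statements for `IsQuadraticExtension`).

## References

* J. H. Silverman, *The Arithmetic of Elliptic Curves*, 2nd ed., GTM 106 (2009), Exercise 10.16.
* D. A. Marcus, *Number Fields*, Universitext (1977; 2nd ed. 2018), Ch. 2, Thm. 1 and Exercise 2.8
  (quadratic fields `ℚ(√m)`, integral bases and discriminants).
-/

noncomputable section

open scoped Classical

open Module

namespace Literature.NumberTheory.QuadraticFields.Quadratic

section Field

variable {F K : Type*} [Field F] [Field K] [Algebra F K]

/-- In a quadratic extension `K/F` there is an element of `K` outside `F` (as `[K : F] ≠ 1`).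
[folklore] -/
theorem exists_not_mem_range_algebraMap (h2 : finrank F K = 2) :
    ∃ z : K, z ∉ Set.range (algebraMap F K) := by
  by_contra! h
  have : (⊥ : Subalgebra F K) = ⊤ := by
    rw [eq_top_iff]
    intro z _
    exact Algebra.mem_bot.mpr (h z)
  rw [Subalgebra.bot_eq_top_iff_finrank_eq_one] at this
  omega

/-- `1, θ` are `F`-linearly independent as soon as `θ ∉ F`. [folklore] -/
theorem linearIndependent_one_pair {θ : K} (hθ : θ ∉ Set.range (algebraMap F K)) :
    LinearIndependent F ![(1 : K), θ] := by
  rw [LinearIndependent.pair_iff]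
  intro s t hst
  rw [Algebra.smul_def, Algebra.smul_def, mul_one] at hst
  by_cases ht : t = 0
  · subst ht
    rw [(algebraMap F K).map_zero, zero_mul, add_zero] at hst
    exact ⟨(algebraMap F K).injective (hst.trans (algebraMap F K).map_zero.symm), rfl⟩
  · exfalso
    apply hθ
    refine ⟨-(s / t), ?_⟩
    have ht' : algebraMap F K t ≠ 0 := by simpa using ht
    rw [(algebraMap F K).map_neg, map_div₀ (algebraMap F K)]
    field_simp
    linear_combination -hst

/-- The range of the pair `1, θ` is `{1, θ}`. [folklore] -/
theorem range_one_pair (θ : K) : Set.range ![(1 : K), θ] = {1, θ} := by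
  ext x
  simp only [Set.mem_range, Fin.exists_fin_two, Matrix.cons_val_zero, Matrix.cons_val_one,
    Set.mem_insert_iff, Set.mem_singleton_iff]
  tauto

/-- In a quadratic extension `K = F ⊕ F θ` for any `θ ∉ F`: every element is `a + b θ`.
[folklore] -/
theorem exists_eq_add_mul (h2 : finrank F K = 2) {θ : K}
    (hθ : θ ∉ Set.range (algebraMap F K)) (x : K) :
    ∃ a b : F, x = algebraMap F K a + algebraMap F K b * θ := by
  have hx : x ∈ Submodule.span F (Set.range ![(1 : K), θ]) := by
    rw [(linearIndependent_one_pair hθ).span_eq_top_of_card_eq_finrank (by simp [h2])]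
    trivial
  rw [range_one_pair] at hx
  obtain ⟨a, b, hab⟩ := Submodule.mem_span_pair.mp hx
  exact ⟨a, b, by rw [← hab, Algebra.smul_def, Algebra.smul_def, mul_one]⟩

/-- The coordinates `a, b` of `a + b θ` (`θ ∉ F`) are unique. [folklore] -/
theorem ext_add_mul {θ : K} (hθ : θ ∉ Set.range (algebraMap F K)) {a b a' b' : F}
    (h : algebraMap F K a + algebraMap F K b * θ = algebraMap F K a' + algebraMap F K b' * θ) :
    a = a' ∧ b = b' := by
  by_cases hb : b = b'
  · subst hb
    exact ⟨(algebraMap F K).injective (add_right_cancel h), rfl⟩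
  · exfalso
    apply hθ
    have hne : algebraMap F K b - algebraMap F K b' ≠ 0 := by
      rw [← (algebraMap F K).map_sub, map_ne_zero]
      exact sub_ne_zero.mpr hb
    refine ⟨(a' - a) / (b - b'), ?_⟩
    rw [map_div₀ (algebraMap F K), (algebraMap F K).map_sub, (algebraMap F K).map_sub,
      div_eq_iff hne]
    linear_combination -h

/-- An element outside `F` is nonzero. [folklore] -/
theorem ne_zero_of_not_mem_range {θ : K} (hθ : θ ∉ Set.range (algebraMap F K)) : θ ≠ 0 :=
  fun h => hθ ⟨0, by rw [(algebraMap F K).map_zero, h]⟩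

/-- If `θ ∉ F` and `θ² = c` then `c ≠ 0`. [folklore] -/
theorem sq_ne_zero_of_not_mem_range {θ : K} {c : F} (hθ : θ ∉ Set.range (algebraMap F K))
    (hc : θ ^ 2 = algebraMap F K c) : c ≠ 0 := by
  rintro rfl
  rw [(algebraMap F K).map_zero, sq_eq_zero_iff] at hc
  exact ne_zero_of_not_mem_range hθ hc

/-! ### The basis `1, θ` and the conjugation `a + bθ ↦ a - bθ` -/

/-- The `F`-basis `1, θ` of a quadratic extension `K/F`, for `θ ∉ F`. [folklore] -/
def basisOneSqrt (h2 : finrank F K = 2) {θ : K} (hθ : θ ∉ Set.range (algebraMap F K)) :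
    Basis (Fin 2) F K :=
  basisOfLinearIndependentOfCardEqFinrank (linearIndependent_one_pair hθ) (by simp [h2])

/-- `basisOneSqrt` is the family `1, θ`. [folklore] -/
@[simp]
theorem coe_basisOneSqrt (h2 : finrank F K = 2) {θ : K} (hθ : θ ∉ Set.range (algebraMap F K)) :
    ⇑(basisOneSqrt h2 hθ) = ![(1 : K), θ] :=
  coe_basisOfLinearIndependentOfCardEqFinrank _ _

/-- The conjugation `a + bθ ↦ a - bθ` as an `F`-linear map (defined on the basis `1, θ`).
[folklore] -/
def conjLinear (h2 : finrank F K = 2) {θ : K} (hθ : θ ∉ Set.range (algebraMap F K)) :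
    K →ₗ[F] K :=
  (basisOneSqrt h2 hθ).constr F ![(1 : K), -θ]

/-- `conjLinear 1 = 1`. [folklore] -/
theorem conjLinear_one (h2 : finrank F K = 2) {θ : K} (hθ : θ ∉ Set.range (algebraMap F K)) :
    conjLinear h2 hθ 1 = 1 := by
  have hb : basisOneSqrt h2 hθ 0 = 1 := by simp
  have h := (basisOneSqrt h2 hθ).constr_basis F ![(1 : K), -θ] 0
  rw [hb] at h
  exact h

/-- `conjLinear θ = -θ`. [folklore] -/
theorem conjLinear_gen (h2 : finrank F K = 2) {θ : K} (hθ : θ ∉ Set.range (algebraMap F K)) :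
    conjLinear h2 hθ θ = -θ := by
  have hb : basisOneSqrt h2 hθ 1 = θ := by simp
  have h := (basisOneSqrt h2 hθ).constr_basis F ![(1 : K), -θ] 1
  rw [hb] at h
  exact h

/-- `conjLinear` fixes `F`. [folklore] -/
theorem conjLinear_algebraMap (h2 : finrank F K = 2) {θ : K}
    (hθ : θ ∉ Set.range (algebraMap F K)) (a : F) :
    conjLinear h2 hθ (algebraMap F K a) = algebraMap F K a := by
  rw [Algebra.algebraMap_eq_smul_one, LinearMap.map_smul, conjLinear_one]

/-- `conjLinear (a + bθ) = a - bθ`. [folklore] -/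
theorem conjLinear_add_mul (h2 : finrank F K = 2) {θ : K}
    (hθ : θ ∉ Set.range (algebraMap F K)) (a b : F) :
    conjLinear h2 hθ (algebraMap F K a + algebraMap F K b * θ) =
      algebraMap F K a - algebraMap F K b * θ := by
  rw [LinearMap.map_add, conjLinear_algebraMap, ← Algebra.smul_def, LinearMap.map_smul,
    conjLinear_gen, smul_neg, Algebra.smul_def, sub_eq_add_neg]

/-- Multiplication in the coordinates `a + bθ` when `θ² = c`:
`(a + bθ)(a' + b'θ) = (aa' + bb'c) + (ab' + ba')θ`. [folklore] -/
theorem add_mul_mul_add_mul {θ : K} {c : F} (hc : θ ^ 2 = algebraMap F K c) (a b a' b' : F) :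
    (algebraMap F K a + algebraMap F K b * θ) * (algebraMap F K a' + algebraMap F K b' * θ) =
      algebraMap F K (a * a' + b * b' * c) + algebraMap F K (a * b' + b * a') * θ := by
  rw [(algebraMap F K).map_add, (algebraMap F K).map_mul, (algebraMap F K).map_mul,
    (algebraMap F K).map_mul, (algebraMap F K).map_add, (algebraMap F K).map_mul,
    (algebraMap F K).map_mul]
  linear_combination algebraMap F K b * algebraMap F K b' * hc

/-- `conjLinear` is multiplicative when `θ² = c ∈ F` (so that `-θ` is the conjugate root of
`X² - c`). [folklore] -/
theorem conjLinear_mul (h2 : finrank F K = 2) {θ : K} {c : F}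
    (hθ : θ ∉ Set.range (algebraMap F K)) (hc : θ ^ 2 = algebraMap F K c) (x y : K) :
    conjLinear h2 hθ (x * y) = conjLinear h2 hθ x * conjLinear h2 hθ y := by
  obtain ⟨a, b, rfl⟩ := exists_eq_add_mul h2 hθ x
  obtain ⟨a', b', rfl⟩ := exists_eq_add_mul h2 hθ y
  rw [add_mul_mul_add_mul hc, conjLinear_add_mul, conjLinear_add_mul, conjLinear_add_mul,
    (algebraMap F K).map_add, (algebraMap F K).map_mul, (algebraMap F K).map_mul,
    (algebraMap F K).map_mul, (algebraMap F K).map_add, (algebraMap F K).map_mul,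
    (algebraMap F K).map_mul]
  linear_combination -(algebraMap F K b * algebraMap F K b') * hc

/-- **The conjugation of a quadratic extension** `K = F(θ)`, `θ² = c ∈ F`, `θ ∉ F`: the
`F`-algebra endomorphism `a + bθ ↦ a - bθ` (the nontrivial `F`-automorphism when `2 ≠ 0`).
[folklore] -/
def conj (h2 : finrank F K = 2) {θ : K} {c : F} (hθ : θ ∉ Set.range (algebraMap F K))
    (hc : θ ^ 2 = algebraMap F K c) : K →ₐ[F] K :=
  AlgHom.ofLinearMap (conjLinear h2 hθ) (conjLinear_one h2 hθ) (conjLinear_mul h2 hθ hc)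

/-- `2 ≠ 0` in `K` when `2 ≠ 0` in `F` (`F → K` is injective). [folklore] -/
theorem two_ne_zero' [NeZero (2 : F)] : (2 : K) ≠ 0 := by
  rw [← map_ofNat (algebraMap F K) 2]
  exact (map_ne_zero _).mpr two_ne_zero

variable (h2 : finrank F K = 2) {θ : K} {c : F} (hθ : θ ∉ Set.range (algebraMap F K))
  (hc : θ ^ 2 = algebraMap F K c)

/-- `conj` is `conjLinear` as a function (by definition). [folklore] -/
theorem conj_apply (x : K) : conj h2 hθ hc x = conjLinear h2 hθ x := rfl

/-- `conj θ = -θ`. [folklore] -/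
theorem conj_gen : conj h2 hθ hc θ = -θ := conjLinear_gen h2 hθ

/-- `conj` fixes `F`. [folklore] -/
theorem conj_algebraMap (a : F) : conj h2 hθ hc (algebraMap F K a) = algebraMap F K a :=
  AlgHom.commutes _ a

/-- `conj (a + bθ) = a - bθ`. [folklore] -/
theorem conj_add_mul (a b : F) :
    conj h2 hθ hc (algebraMap F K a + algebraMap F K b * θ) =
      algebraMap F K a - algebraMap F K b * θ :=
  conjLinear_add_mul h2 hθ a b

/-- `conj (bθ) = -bθ`. [folklore] -/
theorem conj_mul_gen (b : F) : conj h2 hθ hc (algebraMap F K b * θ) = -(algebraMap F K b * θ) := by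
  have h := conj_add_mul h2 hθ hc 0 b
  rwa [(algebraMap F K).map_zero, zero_add, zero_sub] at h

/-- `conj` is an involution. [folklore] -/
theorem conj_conj (x : K) : conj h2 hθ hc (conj h2 hθ hc x) = x := by
  obtain ⟨a, b, rfl⟩ := exists_eq_add_mul h2 hθ x
  rw [conj_add_mul, map_sub, conj_algebraMap, conj_mul_gen, sub_neg_eq_add]

variable [NeZero (2 : F)]

/-- **Fixed points of the conjugation are the base field** (`2 ≠ 0`): `conj x = x ↔ x ∈ F`.
[folklore] -/
theorem exists_eq_algebraMap_of_conj_eq {x : K} (hx : conj h2 hθ hc x = x) :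
    ∃ a : F, x = algebraMap F K a := by
  obtain ⟨a, b, rfl⟩ := exists_eq_add_mul h2 hθ x
  rw [conj_add_mul] at hx
  have h0 : (2 : K) * (algebraMap F K b * θ) = 0 := by linear_combination -hx
  rcases mul_eq_zero.mp h0 with h | h
  · exact absurd h (two_ne_zero' (F := F))
  · exact ⟨a, by rw [h, add_zero]⟩

/-- **Anti-fixed points of the conjugation are `F θ`** (`2 ≠ 0`): `conj x = -x ↔ x ∈ F θ`.
[folklore] -/
theorem exists_eq_mul_of_conj_eq_neg {x : K} (hx : conj h2 hθ hc x = -x) :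
    ∃ b : F, x = algebraMap F K b * θ := by
  obtain ⟨a, b, rfl⟩ := exists_eq_add_mul h2 hθ x
  rw [conj_add_mul] at hx
  have h0 : (2 : K) * algebraMap F K a = 0 := by linear_combination hx
  rcases mul_eq_zero.mp h0 with h | h
  · exact absurd h (two_ne_zero' (F := F))
  · exact ⟨b, by rw [h, zero_add]⟩

include h2 in
/-- **A quadratic extension in characteristic `≠ 2` has a square-root generator**: if
`[K : F] = 2` and `2 ≠ 0` in `F` there is `θ ∈ K \ F` with `θ² = c ∈ F` (so `K = F(√c)`):
for `z ∉ F` with `z² = α + βz` take `θ = z - β/2`, `c = α + β²/4`. [folklore] -/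
theorem exists_sq_eq_algebraMap :
    ∃ (θ : K) (c : F), θ ∉ Set.range (algebraMap F K) ∧ θ ^ 2 = algebraMap F K c := by
  obtain ⟨z, hz⟩ := exists_not_mem_range_algebraMap h2
  obtain ⟨α, β, hz2⟩ := exists_eq_add_mul h2 hz (z * z)
  refine ⟨z - algebraMap F K (β / 2), α + β / 2 * (β / 2), ?_, ?_⟩
  · rintro ⟨q, hq⟩
    exact hz ⟨q + β / 2, by rw [(algebraMap F K).map_add, hq, sub_add_cancel]⟩
  · have e1 : algebraMap F K (β / 2) * 2 = algebraMap F K β := by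
      rw [← map_ofNat (algebraMap F K) 2, ← (algebraMap F K).map_mul,
        div_mul_cancel₀ β two_ne_zero]
    rw [(algebraMap F K).map_add, (algebraMap F K).map_mul]
    linear_combination hz2 - z * e1

end Field

/-! ### The discriminant of a quadratic number field up to squares -/

section NumberField

variable {K : Type*} [Field K] [NumberField K]

/-- `disc_ℚ(1, θ) = 4c` for `θ² = c`, `θ ∉ ℚ`: the trace form on the basis `1, θ` has matrix
`diag(2, 2c)` (`Tr 1 = 2`, `Tr θ = 0`, `Tr θ² = 2c`). Marcus, *Number Fields*, Ch. 2 (computation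
of `disc(1, √m)`). [folklore] -/
theorem discr_basisOneSqrt (h2 : finrank ℚ K = 2) {θ : K} {c : ℚ}
    (hθ : θ ∉ Set.range (algebraMap ℚ K)) (hc : θ ^ 2 = algebraMap ℚ K c) :
    Algebra.discr ℚ ⇑(basisOneSqrt h2 hθ) = 4 * c := by
  set b := basisOneSqrt h2 hθ with hb
  have hθθ : θ * θ = algebraMap ℚ K c := by rw [← sq, hc]
  have hb0 : b 0 = 1 := by simp [hb]
  have hb1 : b 1 = θ := by simp [hb]
  -- traces of the basis products
  have tr1 : Algebra.trace ℚ K 1 = 2 := by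
    rw [← (algebraMap ℚ K).map_one, Algebra.trace_algebraMap, h2]
    norm_num
  have trθ : Algebra.trace ℚ K θ = 0 := by
    rw [Algebra.trace_eq_matrix_trace b, Matrix.trace_fin_two, Algebra.leftMulMatrix_eq_repr_mul,
      Algebra.leftMulMatrix_eq_repr_mul, hb0, hb1, mul_one, hθθ, Algebra.algebraMap_eq_smul_one,
      ← hb0, ← hb1, b.repr_self, LinearEquiv.map_smul, b.repr_self]
    simp
  have trθθ : Algebra.trace ℚ K (θ * θ) = 2 * c := by
    rw [hθθ, Algebra.trace_algebraMap, h2, nsmul_eq_mul, Nat.cast_ofNat]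
  rw [Algebra.discr_def, Matrix.det_fin_two, Algebra.traceMatrix_apply, Algebra.traceMatrix_apply,
    Algebra.traceMatrix_apply, Algebra.traceMatrix_apply, Algebra.traceForm_apply,
    Algebra.traceForm_apply, Algebra.traceForm_apply, Algebra.traceForm_apply, hb0, hb1, mul_one,
    one_mul, tr1, trθ, trθθ]
  ring

/-- **The discriminant of a quadratic field is its radicand up to squares**: if `[K : ℚ] = 2`
and `K ∋ θ ∉ ℚ` with `θ² = c`, then `d_K = c q²` for some rational `q ≠ 0` (change of basis
from an integral basis to `1, θ`: `4c = disc(1, θ) = det(P)² d_K`). In particular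
`K = ℚ(√c) = ℚ(√d_K)`. Marcus, *Number Fields*, Ch. 2, Thm. 1 and Exercise 2.8 (`d_K = m` or `4m`
for `K = ℚ(√m)`, `m` squarefree). [folklore] -/
theorem _root_.NumberField.exists_discr_eq_mul_sq (h2 : finrank ℚ K = 2) {θ : K} {c : ℚ}
    (hθ : θ ∉ Set.range (algebraMap ℚ K)) (hc : θ ^ 2 = algebraMap ℚ K c) :
    ∃ q : ℚ, q ≠ 0 ∧ (NumberField.discr K : ℚ) = c * q ^ 2 := by
  set b := basisOneSqrt h2 hθ with hb
  -- an integral basis, reindexed by `Fin 2`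
  have hcard : Fintype.card (Free.ChooseBasisIndex ℤ (NumberField.RingOfIntegers K)) = 2 := by
    rw [← finrank_eq_card_basis (NumberField.integralBasis K), h2]
  set e := Fintype.equivFinOfCardEq hcard with he
  set b' : Basis (Fin 2) ℚ K := (NumberField.integralBasis K).reindex e with hb'
  have hdisc' : Algebra.discr ℚ ⇑b' = NumberField.discr K := by
    rw [hb', Basis.coe_reindex, Algebra.discr_reindex, NumberField.coe_discr]
  -- change of basis
  set P := b'.toMatrix ⇑b with hP
  have hvec : Matrix.vecMul ⇑b' (P.map (algebraMap ℚ K)) = ⇑b := b'.toMatrix_map_vecMul ⇑b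
  have key : 4 * c = P.det ^ 2 * NumberField.discr K := by
    rw [← discr_basisOneSqrt h2 hθ hc, ← hdisc', ← hb, ← hvec, Algebra.discr_of_matrix_vecMul]
  have hc0 : c ≠ 0 := sq_ne_zero_of_not_mem_range hθ hc
  have hdet : P.det ≠ 0 := by
    intro h0
    rw [h0, zero_pow two_ne_zero, zero_mul] at key
    exact hc0 (by linarith)
  refine ⟨2 / P.det, div_ne_zero two_ne_zero hdet, ?_⟩
  field_simp
  linear_combination -key

end NumberField

end Literature.NumberTheory.QuadraticFields.Quadratic

end
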